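import Literature.NumberTheory.IwasawaTheory.ImaginaryQuadraticTwoTowerDyadicClassNotSquare
import Literature.NumberTheory.IwasawaTheory.FukudaGrowthStepFixedNonsquare
import Literature.NumberTheory.NumberFields.ClassGroupNormSurjective
import HarnessLib

/-!
# Ferrero–Kida for `ℚ(√−d)`, `d ≡ 1 (mod 4)`: the upper bound `λ₂ ≤ Σ − 1` and the exact value `λ₂ + 1 = Σ_{ℓ ∣ d} 2^{ord₂(ℓ²−1)−3}`

Topic `NumberTheory/IwasawaTheory`; namespace `Literature.NumberTheory.IwasawaTheory`.  Theorem-only file (no definition, no named fact,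
no `sorry`), unconditional.

`K ∋ √−d` of degree `2`, `d ≡ 1 (mod 4)` squarefree, `d ≠ 1`; `κ₀ = (ℚ_∞)|_K`, `K_m = κ₀.layer m`, `e_m = ord₂ h(K_m)`, `r = Σ_{ℓ ∣ d} 2^{ord₂(ℓ²−1)−3}` the stable
`2`-rank (tree `classGroupPRank_cyclotomic_two_eq_ferreroKidaSum_of_sq_eq_neg`).

* §1 `classNumberPExp_succ_le_add_of_dyadic` — **`e_{b+k+1} ≤ e_{b+k} + (r − 1)`** for `r ≤ 2^{k₀}`, `k₀ + 1 ≤ k`, `k + 1 ≤ t`, `rank₂ Cl(K_{b+t}) = r`,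
  provided the dyadic class `[𝔓_{b+t}]` is not a square in `Cl(K_{b+t})`.  Seen from `K_b`, the top layer `T = K_{b+t}` carries the action of a generator `σ_b`
  of `Gal(T/K_b)` (acting as `γ^{2^b}`, tree `exists_topGenerator_pow_aut_forall_classGroupNorm_eq_one_iff`); the norm kernels `H_s = ker N_{T/K_s}`
  (`s = b+k, b+k+1`) are `(σ_b^{2^{s−b}} − 1)Cl(T)` with their `2`-primary refinement, `N_{T/K_s}` is onto (total ramification), so
  `#Cl(T) = #Cl(K_s)·#H_s`, and the group-theoretic step `FukudaNakayama.padicValNat_card_le_add_of_fixed_nonsquare` (the Fukuda step with the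
  `σ_b`-invariant non-square class `[𝔓_T]` of order `2`) gives `ord₂ #H_{b+k} ≤ ord₂ #H_{b+k+1} + (r − 1)`.
* §2 `classicalLambda_add_one_eq_ferreroKidaSum_of_mod_four_eq_one` — ★ **`μ₂ = 0` and `λ₂(K_∞/K) + 1 = Σ_{p ∈ primeFactors d ∖ {2}} 2^{v₂(p²−1)−3}`
  for every cyclotomic `ℤ₂`-extension of `K`**: the lower bound `Σ ≤ λ + 1` is the tree's `ferreroKidaSum_le_classicalLambda_add_one_of_mod_four_eq_one`;
  the upper bound is §1 at a deep layer (`e_{m+1} − e_m = λ` eventually, `[𝔓_m]` not a square eventually, tree `exists_forall_mk0_dyadic_not_mem_range_pow_two`).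

This is the `2`-RAMIFIED half (`d_K = −4d`, `d ≡ 1 (mod 4)`) of the named fact `ferreroKida_classicalLambda_two_imaginaryQuadratic`; the half `d ≡ 3 (mod 4)` is the
tree's `ferreroKida_of_sq_eq_neg`, and `d` even remains.

## References

* B. Ferrero, *The cyclotomic ℤ₂-extension of imaginary quadratic fields*, Amer. J. Math. 102 (1980) 447–459, Thm. and §3. [Ferrero1980AJM]
* Y. Kida, *On cyclotomic ℤ₂-extensions of imaginary quadratic fields*, Tohoku Math. J. 31 (1979) 91–96, Thm. 1. [Kida1979Tohoku]
* T. Fukuda, *Remarks on ℤ_p-extensions of number fields*, Proc. Japan Acad. 70 (1994) 264–266. [Fukuda1994]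
* L. C. Washington, *Introduction to Cyclotomic Fields*, GTM 83, Springer 1997, §13.3. [Washington1997]
-/

noncomputable section

open NumberField IsDedekindDomain IntermediateField
open scoped nonZeroDivisors

namespace Literature.NumberTheory.IwasawaTheory

open Literature.NumberTheory.EllipticCurves Literature.NumberTheory.EllipticCurves.ZpExtension
  Literature.NumberTheory.EllipticCurves.CoatesSujatha2005 Literature.NumberTheory.GaloisRepresentations
  Literature.NumberTheory.NumberFields

variable (K : Type) [Field K] [NumberField K]

/-- `σ ↦ ClassGroup.mulEquiv (intAut σ)` is multiplicative: the action of `σ^i` is the `i`-th power of the action of `σ` in `Aut Cl(L)` (auxiliary).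
[folklore] -/
private theorem mulEquiv_intAut_pow' {F L : Type} [Field F] [Field L] [NumberField L] [Algebra F L] (σ : L ≃ₐ[F] L) (i : ℕ) :
    (ClassGroup.mulEquiv (AmbiguousClass.intAut (σ ^ i)) : MulAut (ClassGroup (𝓞 L))) =
      (ClassGroup.mulEquiv (AmbiguousClass.intAut σ) : MulAut (ClassGroup (𝓞 L))) ^ i := by
  induction i with
  | zero => rw [pow_zero, pow_zero, AmbiguousClass.mulEquiv_intAut_one, MulAut.one_def]
  | succ i ih => rw [pow_succ', pow_succ', AmbiguousClass.mulEquiv_intAut_mul, ih, MulAut.mul_def]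

/-! ## §1 The growth step with the dyadic class -/

/-- ★ **`e_{b+k+1} ≤ e_{b+k} + (r − 1)`** in the cyclotomic `ℤ₂`-tower `κ₀ = (ℚ_∞)|_K` of `K ∋ √−d` (`d ≡ 1 (mod 4)` squarefree, `d ≠ 1`), for `1 ≤ r ≤ 2^{k₀}`,
`k₀ + 1 ≤ k`, `k + 1 ≤ t`, `rank₂ Cl(K_{b+t}) = r`, when the class of the prime of `K_{b+t}` above `2` is not a square in `Cl(K_{b+t})`
(Fukuda's step for `T = K_{b+t}` over `K_b` with the invariant non-square class `[𝔓_T]`; the norm kernels `ker N_{T/K_s}` are onto-complements of `Cl(K_s)`).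
[cite: Fukuda1994, Thm. 1 (proof)] [cite: Washington1997, §13.3 Lemma 13.15, Prop. 13.22–13.23] [cite: Ferrero1980AJM, §3] -/
theorem classNumberPExp_succ_le_add_of_dyadic (hK2 : Module.finrank ℚ K = 2) {d : ℕ} (hd4 : d % 4 = 1)
    (hη : ∃ η : K, η ^ 2 = -((d : ℕ) : K))
    (h : Function.Surjective ((CyclotomicZp.zpExtension 2).toContinuousMonoidHom.comp (absGaloisRestrict ℚ K))) (b t : ℕ) {r k₀ k : ℕ} (hr1 : 1 ≤ r)
    (hk₀ : r ≤ 2 ^ k₀) (hk : k₀ + 1 ≤ k) (hkt : k + 1 ≤ t) [NumberField ↥(((CyclotomicZp.zpExtension 2).restrict K h).layer (b + t))]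
    (hrank : classGroupPRank ((CyclotomicZp.zpExtension 2).restrict K h) (b + t) = r)
    (hF2 : ∀ 𝔓 : HeightOneSpectrum (𝓞 ↥(((CyclotomicZp.zpExtension 2).restrict K h).layer (b + t))), (2 : 𝓞 ↥(((CyclotomicZp.zpExtension 2).restrict K h).layer (b + t))) ∈ 𝔓.asIdeal →
      ClassGroup.mk0 ⟨𝔓.asIdeal, mem_nonZeroDivisors_of_ne_zero 𝔓.ne_bot⟩ ∉
        (powMonoidHom 2 : ClassGroup (𝓞 ↥(((CyclotomicZp.zpExtension 2).restrict K h).layer (b + t))) →* ClassGroup (𝓞 ↥(((CyclotomicZp.zpExtension 2).restrict K h).layer (b + t)))).range) :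
    classNumberPExp ((CyclotomicZp.zpExtension 2).restrict K h) (b + k + 1) ≤ classNumberPExp ((CyclotomicZp.zpExtension 2).restrict K h) (b + k) + (r - 1) := by
  classical
  haveI : Fact (Nat.Prime 2) := ⟨Nat.prime_two⟩
  have hcyc : (CyclotomicZp.zpExtension 2).IsCyclotomic := CyclotomicZp.isCyclotomic_zpExtension 2
  have hκ₀c : ((CyclotomicZp.zpExtension 2).restrict K h).IsCyclotomic := isCyclotomic_restrict (CyclotomicZp.zpExtension 2) hcyc K h
  have hTR : TotallyRamifiedFrom ((CyclotomicZp.zpExtension 2).restrict K h) 0 := totallyRamifiedFrom_zero_of_sq_eq_neg_of_mod_four_eq_one K hK2 hd4 hη ((CyclotomicZp.zpExtension 2).restrict K h) hκ₀c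
  obtain ⟨v₀, -, -, huniqv₀⟩ := exists_dyadic_prime_of_sq_eq_neg K hK2 hd4 hη
  have hv₀ : ∀ w : HeightOneSpectrum (𝓞 K), ((2 : ℕ) : 𝓞 K) ∈ w.asIdeal → w = v₀ := fun w hw => huniqv₀ w (by exact_mod_cast hw)
  obtain ⟨γ, hγ⟩ : ∃ γ, ((CyclotomicZp.zpExtension 2).restrict K h).IsTopGenerator γ := ((CyclotomicZp.zpExtension 2).restrict K h).surjective (Multiplicative.ofAdd 1)
  -- ### `T = K_{b+t}` over `K_b`: the generator `σ_b`
  haveI : FiniteDimensional K ↥(((CyclotomicZp.zpExtension 2).restrict K h).layer (b)) := ((CyclotomicZp.zpExtension 2).restrict K h).finiteDimensional_layer_holds _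
  haveI : NumberField ↥(((CyclotomicZp.zpExtension 2).restrict K h).layer (b)) := NumberField.of_module_finite K _
  haveI : FiniteDimensional K ↥(((CyclotomicZp.zpExtension 2).restrict K h).layer (b + t)) := ((CyclotomicZp.zpExtension 2).restrict K h).finiteDimensional_layer_holds _
  haveI : IsGalois K ↥(((CyclotomicZp.zpExtension 2).restrict K h).layer (b + t)) := ((CyclotomicZp.zpExtension 2).restrict K h).isGalois_layer_holds _
  letI : Algebra ↥(((CyclotomicZp.zpExtension 2).restrict K h).layer (b)) ↥(((CyclotomicZp.zpExtension 2).restrict K h).layer (b + t)) := (IntermediateField.inclusion (((CyclotomicZp.zpExtension 2).restrict K h).layer_mono (Nat.le_add_right b t))).toRingHom.toAlgebra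
  haveI : IsScalarTower K ↥(((CyclotomicZp.zpExtension 2).restrict K h).layer (b)) ↥(((CyclotomicZp.zpExtension 2).restrict K h).layer (b + t)) :=
    IsScalarTower.of_algebraMap_eq fun x => ((IntermediateField.inclusion (((CyclotomicZp.zpExtension 2).restrict K h).layer_mono (Nat.le_add_right b t))).commutes x).symm
  haveI : FiniteDimensional ↥(((CyclotomicZp.zpExtension 2).restrict K h).layer (b)) ↥(((CyclotomicZp.zpExtension 2).restrict K h).layer (b + t)) := Module.Finite.of_restrictScalars_finite K _ _
  obtain ⟨σb, hactb, hzb, -, -⟩ := exists_topGenerator_pow_aut_forall_classGroupNorm_eq_one_iff ((CyclotomicZp.zpExtension 2).restrict K h) hTR v₀ hv₀ hγ (Nat.le_add_right b t)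
  set g : MulAut (ClassGroup (𝓞 ↥(((CyclotomicZp.zpExtension 2).restrict K h).layer (b + t)))) := ClassGroup.mulEquiv (AmbiguousClass.intAut σb) with hgdef
  have hordb : orderOf σb = 2 ^ t := by
    rw [orderOf_eq_of_zpowers_eq_top_layer_layer ((CyclotomicZp.zpExtension 2).restrict K h) (Nat.le_add_right b t) hzb, Nat.add_sub_cancel_left]
  have hg : g ^ (2 ^ t) = 1 := by
    rw [hgdef, ← mulEquiv_intAut_pow', ← hordb, pow_orderOf_eq_one, AmbiguousClass.mulEquiv_intAut_one, MulAut.one_def]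
  have hactpow : ∀ (n : ℕ) (x : ↥(((CyclotomicZp.zpExtension 2).restrict K h).layer (b + t))), ((((σb ^ n) x : ↥(((CyclotomicZp.zpExtension 2).restrict K h).layer (b + t)))) : AlgebraicClosure K) = (γ ^ 2 ^ b) ^ n • (x : AlgebraicClosure K) := by
    intro n
    induction n with
    | zero => intro x; rw [pow_zero, pow_zero, one_smul, AlgEquiv.one_apply]
    | succ n ih => intro x; rw [pow_succ, AlgEquiv.mul_apply, ih, hactb, ← mul_smul, ← pow_succ]
  -- ### the pairs `K_s ⊆ T`, `s = b + k'`: norm kernels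
  have hpair : ∀ (k' s : ℕ), s = b + k' → ∀ hst : s ≤ b + t, ∃ H : Subgroup (ClassGroup (𝓞 ↥(((CyclotomicZp.zpExtension 2).restrict K h).layer (b + t)))),
      classNumberPExp ((CyclotomicZp.zpExtension 2).restrict K h) (b + t) = classNumberPExp ((CyclotomicZp.zpExtension 2).restrict K h) s + padicValNat 2 (Nat.card H) ∧
      (∀ x ∈ H, x ^ 2 ^ (Nat.card (ClassGroup (𝓞 ↥(((CyclotomicZp.zpExtension 2).restrict K h).layer (b + t))))).factorization 2 = 1 →
        ∃ e : ClassGroup (𝓞 ↥(((CyclotomicZp.zpExtension 2).restrict K h).layer (b + t))), e ^ 2 ^ (Nat.card (ClassGroup (𝓞 ↥(((CyclotomicZp.zpExtension 2).restrict K h).layer (b + t))))).factorization 2 = 1 ∧ x = (g ^ (2 ^ k')) e / e) ∧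
      (∀ e : ClassGroup (𝓞 ↥(((CyclotomicZp.zpExtension 2).restrict K h).layer (b + t))), (g ^ (2 ^ k')) e / e ∈ H) := by
    intro k' s hs hst
    subst hs
    haveI : FiniteDimensional K ↥(((CyclotomicZp.zpExtension 2).restrict K h).layer (b + k')) := ((CyclotomicZp.zpExtension 2).restrict K h).finiteDimensional_layer_holds _
    haveI : NumberField ↥(((CyclotomicZp.zpExtension 2).restrict K h).layer (b + k')) := NumberField.of_module_finite K _
    haveI : IsGalois K ↥(((CyclotomicZp.zpExtension 2).restrict K h).layer (b + k')) := ((CyclotomicZp.zpExtension 2).restrict K h).isGalois_layer_holds _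
    letI : Algebra ↥(((CyclotomicZp.zpExtension 2).restrict K h).layer (b + k')) ↥(((CyclotomicZp.zpExtension 2).restrict K h).layer (b + t)) := (IntermediateField.inclusion (((CyclotomicZp.zpExtension 2).restrict K h).layer_mono hst)).toRingHom.toAlgebra
    haveI : IsScalarTower K ↥(((CyclotomicZp.zpExtension 2).restrict K h).layer (b + k')) ↥(((CyclotomicZp.zpExtension 2).restrict K h).layer (b + t)) :=
      IsScalarTower.of_algebraMap_eq fun x => ((IntermediateField.inclusion (((CyclotomicZp.zpExtension 2).restrict K h).layer_mono hst)).commutes x).symm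
    haveI : FiniteDimensional ↥(((CyclotomicZp.zpExtension 2).restrict K h).layer (b + k')) ↥(((CyclotomicZp.zpExtension 2).restrict K h).layer (b + t)) := Module.Finite.of_restrictScalars_finite K _ _
    haveI : IsGalois ↥(((CyclotomicZp.zpExtension 2).restrict K h).layer (b + k')) ↥(((CyclotomicZp.zpExtension 2).restrict K h).layer (b + t)) := isGalois_layer_layer ((CyclotomicZp.zpExtension 2).restrict K h)
    obtain ⟨σ₁, hact₁, -, hiff₁, href₁⟩ := exists_topGenerator_pow_aut_forall_classGroupNorm_eq_one_iff ((CyclotomicZp.zpExtension 2).restrict K h) hTR v₀ hv₀ hγ hst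
    -- `σ_s` acts as `σ_b^{2^k'}`
    have hint : AmbiguousClass.intAut σ₁ = AmbiguousClass.intAut (σb ^ (2 ^ k')) := by
      refine RingEquiv.ext fun y => RingOfIntegers.ext (Subtype.ext ?_)
      change ((σ₁ (y : ↥(((CyclotomicZp.zpExtension 2).restrict K h).layer (b + t))) : ↥(((CyclotomicZp.zpExtension 2).restrict K h).layer (b + t))) : AlgebraicClosure K) = (((σb ^ 2 ^ k') (y : ↥(((CyclotomicZp.zpExtension 2).restrict K h).layer (b + t))) : ↥(((CyclotomicZp.zpExtension 2).restrict K h).layer (b + t))) : AlgebraicClosure K)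
      rw [hact₁, hactpow, ← pow_mul, ← pow_add]
    have hrel : ∀ e : ClassGroup (𝓞 ↥(((CyclotomicZp.zpExtension 2).restrict K h).layer (b + t))), ClassGroup.mulEquiv (AmbiguousClass.intAut σ₁) e = (g ^ (2 ^ k')) e := fun e => by
      have hmul : (ClassGroup.mulEquiv (AmbiguousClass.intAut σ₁) : MulAut (ClassGroup (𝓞 ↥(((CyclotomicZp.zpExtension 2).restrict K h).layer (b + t))))) = g ^ (2 ^ k') := by
        rw [hint, hgdef, mulEquiv_intAut_pow']
      exact MulEquiv.congr_fun hmul e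
    -- the norm is onto: `𝔓_T` is totally ramified over `K_s`
    obtain ⟨𝔓T, -, heT, -⟩ := exists_unique_dyadic_layer_restrict K hK2 hd4 hη h (b + t)
    haveI := 𝔓T.isMaximal
    have heK : 𝔓T.asIdeal.ramificationIdx (𝓞 K) = Module.finrank K ↥(((CyclotomicZp.zpExtension 2).restrict K h).layer (b + t)) := by rw [heT, ((CyclotomicZp.zpExtension 2).restrict K h).finrank_layer_holds]
    have heS : 𝔓T.asIdeal.ramificationIdx (𝓞 ↥(((CyclotomicZp.zpExtension 2).restrict K h).layer (b + k'))) = Module.finrank ↥(((CyclotomicZp.zpExtension 2).restrict K h).layer (b + k')) ↥(((CyclotomicZp.zpExtension 2).restrict K h).layer (b + t)) :=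
      ClassGroupNormKernel.ramificationIdx_eq_finrank_top (B := K) 𝔓T.asIdeal heK
    have hsurj := classGroupNorm_surjective_of_ramificationIdx_eq_finrank ↥(((CyclotomicZp.zpExtension 2).restrict K h).layer (b + k')) ↥(((CyclotomicZp.zpExtension 2).restrict K h).layer (b + t)) 𝔓T.asIdeal heS
    have hcard : Nat.card (ClassGroup (𝓞 ↥(((CyclotomicZp.zpExtension 2).restrict K h).layer (b + t)))) =
        Nat.card (ClassGroup (𝓞 ↥(((CyclotomicZp.zpExtension 2).restrict K h).layer (b + k')))) * Nat.card (classGroupNorm ↥(((CyclotomicZp.zpExtension 2).restrict K h).layer (b + k')) ↥(((CyclotomicZp.zpExtension 2).restrict K h).layer (b + t))).ker := by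
      rw [← Nat.card_congr (QuotientGroup.quotientKerEquivOfSurjective _ hsurj).toEquiv]
      exact Subgroup.card_eq_card_quotient_mul_card_subgroup _
    refine ⟨(classGroupNorm ↥(((CyclotomicZp.zpExtension 2).restrict K h).layer (b + k')) ↥(((CyclotomicZp.zpExtension 2).restrict K h).layer (b + t))).ker, ?_, ?_, ?_⟩
    · rw [classNumberPExp_def, classNumberPExp_def, hcard, padicValNat.mul Nat.card_pos.ne' Nat.card_pos.ne']
    · intro x hx hxa
      rw [MonoidHom.mem_ker] at hx
      rw [Nat.card_eq_fintype_card] at hxa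
      obtain ⟨e, he, hxe⟩ := href₁ hxa hx
      refine ⟨e, by rwa [Nat.card_eq_fintype_card], ?_⟩
      rw [hxe, hrel]
    · intro e
      rw [MonoidHom.mem_ker, hiff₁]
      exact ⟨e, by rw [hrel]⟩
  -- ### the two kernels and the abstract step
  obtain ⟨H₁, he₁, hH₁, -⟩ := hpair k (b + k) rfl (by omega)
  obtain ⟨H₂, he₂, -, hH₂⟩ := hpair (k + 1) (b + k + 1) (by omega) (by omega)
  obtain ⟨𝔓T, h2T, -, huniqT⟩ := exists_unique_dyadic_layer_restrict K hK2 hd4 hη h (b + t)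
  have hc2 := mk0_dyadic_sq_eq_one_layer_restrict K hK2 hd4 hη h (b + t) 𝔓T h2T
  have hgc : g (ClassGroup.mk0 ⟨𝔓T.asIdeal, mem_nonZeroDivisors_of_ne_zero 𝔓T.ne_bot⟩) =
      ClassGroup.mk0 ⟨𝔓T.asIdeal, mem_nonZeroDivisors_of_ne_zero 𝔓T.ne_bot⟩ :=
    mulEquiv_intAut_mk0_eq_of_unique σb 𝔓T h2T huniqT
  have hrB : Nat.card {x : ClassGroup (𝓞 ↥(((CyclotomicZp.zpExtension 2).restrict K h).layer (b + t))) // x ^ 2 = 1} = 2 ^ r := by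
    rw [natCard_torsion_classGroup_layer_eq ((CyclotomicZp.zpExtension 2).restrict K h) (b + t), hrank]
  have key := FukudaNakayama.padicValNat_card_le_add_of_fixed_nonsquare g hg _ hc2 hgc (hF2 𝔓T h2T) hrB hr1 hk₀ hk H₁ H₂ hH₁ hH₂
  omega

/-! ## §2 Ferrero–Kida for `d ≡ 1 (mod 4)` -/

/-- ★★ **FERRERO–KIDA for `ℚ(√−d)`, `d ≡ 1 (mod 4)`: `μ₂ = 0` and `λ₂ + 1 = Σ_{p ∈ primeFactors d ∖ {2}} 2^{v₂(p²−1)−3}`** for every cyclotomic `ℤ₂`-extension of a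
number field `K` of degree `2` containing `η` with `η² = −d`, `d ≡ 1 (mod 4)` squarefree, `d ≠ 1` (the `2`-ramified half, `d_K = −4d`, of the named fact
`ferreroKida_classicalLambda_two_imaginaryQuadratic`).  Lower bound: tree `ferreroKidaSum_le_classicalLambda_add_one_of_mod_four_eq_one`; upper bound: §1 at a deep layer
(`e_{m+1} − e_m = λ`, the `2`-rank is the stable value `Σ`, and the dyadic class is not a square, tree `exists_forall_mk0_dyadic_not_mem_range_pow_two`).
[cite: Ferrero1980AJM, Thm.] [cite: Kida1979Tohoku, Thm. 1] [cite: Washington1997, §13.3 Thm. 13.13 and Prop. 13.22–13.23] -/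
theorem classicalLambda_add_one_eq_ferreroKidaSum_of_mod_four_eq_one (hK2 : Module.finrank ℚ K = 2) {d : ℕ} (hsf : Squarefree d)
    (hd4 : d % 4 = 1) (hd1 : d ≠ 1) (hη : ∃ η : K, η ^ 2 = -((d : ℕ) : K)) (κ : ZpExtension K 2) (hκ : κ.IsCyclotomic) :
    ClassicalMuVanishes κ ∧ classicalLambda κ + 1 = ∑ p ∈ d.primeFactors.erase 2, 2 ^ (padicValNat 2 (p ^ 2 - 1) - 3) := by
  classical
  haveI : Fact (Nat.Prime 2) := ⟨Nat.prime_two⟩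
  obtain ⟨hμ, hle1, -⟩ := ferreroKidaSum_le_classicalLambda_add_one_of_mod_four_eq_one K hK2 hsf hd4 hd1 hη κ hκ
  refine ⟨hμ, le_antisymm ?_ hle1⟩
  set S : ℕ := ∑ p ∈ d.primeFactors.erase 2, 2 ^ (padicValNat 2 (p ^ 2 - 1) - 3) with hS
  -- `S ≥ 1`: `d` has an odd prime factor
  have hS1 : 1 ≤ S := by
    obtain ⟨ℓ, hℓp, hℓd⟩ := Nat.exists_prime_and_dvd hd1
    have hℓ2 : ℓ ≠ 2 := by rintro rfl; omega
    have hmem : ℓ ∈ d.primeFactors.erase 2 := Finset.mem_erase.mpr ⟨hℓ2, Nat.mem_primeFactors.mpr ⟨hℓp, hℓd, by omega⟩⟩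
    have h1 : 2 ^ (padicValNat 2 (ℓ ^ 2 - 1) - 3) ≤ S :=
      Finset.single_le_sum (f := fun p => 2 ^ (padicValNat 2 (p ^ 2 - 1) - 3)) (fun _ _ => Nat.zero_le _) hmem
    exact le_trans Nat.one_le_two_pow h1
  -- the restricted cyclotomic tower `κ₀`
  have hcyc : (CyclotomicZp.zpExtension 2).IsCyclotomic := CyclotomicZp.isCyclotomic_zpExtension 2
  have hIQ := isImaginaryQuadratic_of_sq_eq_neg K hK2 (by omega) hη
  have h := surjective_comp_absGaloisRestrict_imaginaryQuadratic_two hcyc K hIQ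
  have hκ₀c : ((CyclotomicZp.zpExtension 2).restrict K h).IsCyclotomic := isCyclotomic_restrict (CyclotomicZp.zpExtension 2) hcyc K h
  have hμ₀ : ClassicalMuVanishes ((CyclotomicZp.zpExtension 2).restrict K h) := classicalMuVanishes_imaginaryQuadratic_cyclotomic_two K hIQ ((CyclotomicZp.zpExtension 2).restrict K h) hκ₀c
  obtain ⟨n₂, hn₂⟩ := classNumberPExp_succ_sub_eq_classicalLambda ((CyclotomicZp.zpExtension 2).restrict K h) hμ₀
  set n₀ := d.primeFactors.sup (fun ℓ => padicValNat 2 (ℓ ^ 2 - 1) - 3) with hn₀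
  have hn₀' : ∀ ℓ ∈ d.primeFactors, padicValNat 2 (ℓ ^ 2 - 1) - 3 ≤ n₀ := fun ℓ hℓ =>
    Finset.le_sup (f := fun ℓ => padicValNat 2 (ℓ ^ 2 - 1) - 3) hℓ
  obtain ⟨m₁, hm₁⟩ := exists_forall_mk0_dyadic_not_mem_range_pow_two K hK2 hsf hd4 hd1 hη h
  set b : ℕ := max (max 2 n₂) (max n₀ m₁) with hb
  have hbn₂ : n₂ ≤ b := (le_max_left _ _).trans' (le_max_right _ _)
  have hbn₀ : n₀ ≤ b := (le_max_right _ _).trans' (le_max_left _ _)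
  have hbm₁ : m₁ ≤ b := (le_max_right _ _).trans' (le_max_right _ _)
  haveI : FiniteDimensional K ↥(((CyclotomicZp.zpExtension 2).restrict K h).layer (b + (S + 2))) := ((CyclotomicZp.zpExtension 2).restrict K h).finiteDimensional_layer_holds _
  haveI : NumberField ↥(((CyclotomicZp.zpExtension 2).restrict K h).layer (b + (S + 2))) := NumberField.of_module_finite K _
  have hrank : classGroupPRank ((CyclotomicZp.zpExtension 2).restrict K h) (b + (S + 2)) = S :=
    classGroupPRank_cyclotomic_two_eq_ferreroKidaSum_of_sq_eq_neg K hK2 hsf hd4 hη ((CyclotomicZp.zpExtension 2).restrict K h) hκ₀c hn₀' (by omega)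
  have hF2 := hm₁ (b + (S + 2)) (by omega)
  have hub := classNumberPExp_succ_le_add_of_dyadic K hK2 hd4 hη h b (S + 2) (k₀ := S) (k := S + 1) hS1
    Nat.lt_two_pow_self.le le_rfl le_rfl hrank hF2
  have hdiff := hn₂ (b + (S + 1)) (by omega)
  rw [classicalLambda_eq_of_isCyclotomic κ ((CyclotomicZp.zpExtension 2).restrict K h) hκ hκ₀c]
  have h1 : (classNumberPExp ((CyclotomicZp.zpExtension 2).restrict K h) (b + (S + 1) + 1) : ℤ) ≤ classNumberPExp ((CyclotomicZp.zpExtension 2).restrict K h) (b + (S + 1)) + (S - 1 : ℕ) := by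
    exact_mod_cast hub
  have hS' : ((S - 1 : ℕ) : ℤ) = S - 1 := by omega
  omega

end Literature.NumberTheory.IwasawaTheory

end
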